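import Summits.ValiantsHypothesis.ValiantsHypothesis.Theorems.MonotoneRestorationOrbitRestorationQPValueOrbitFinset
import Summits.ValiantsHypothesis.ValiantsHypothesis.Theorems.MonotoneRestorationOrbitRestorationQPRestorable
import Summits.ValiantsHypothesis.ValiantsHypothesis.Theorems.MonotoneRestorationOrbitRestorationQPPiSigmaClass
import Summits.ValiantsHypothesis.ValiantsHypothesis.Theorems.MonotoneRestorationOrbitRestorationQPExplicitForm
import HarnessLib

/-!
# The rung A_∞ is equivalent to its UNIFORM LEVELWISE form (crux `OrbitRestorationQP`, stmt-ValiantsHypothesis-18293)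

Line `depth_three_rung` (skeleton 5d811172), stub `stub_sigmaPiSigmaValue` (A_∞).  Namespace
`Summit.ValiantsHypothesis.ValiantsHypothesis.Theorems.OrbitRestorationQPDepthThreeRung.UniformForm`.

The registered stub quantifies over FAMILIES: every matrix-symmetric family lying in `PDClass 1 · c` for one `c` is
restorable with one constant `c'` — where `c'` may depend on the family.  All three predicates involved
(`IsMatrixSymmetric`, `PDClass`, `QPOrbitRestorable`) are LEVELWISE, and this file proves that the family quantifier can be
traded for a uniform constant:

* `sigmaPiSigmaValue_iff_uniform` — **A_∞ ⟺ ∀ c ∃ c' ∀ n ∀ q, (q matrix-symmetric at level n ∧ q ∈ PDClass 1 n c) →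
  QPOrbitRestorable c' n q.**  (`⇐` is trivial.  `⇒` is a diagonal argument: if uniformity failed at exponent `c`, pick
  for every `c'` a bad level `n(c')` and a bad `q(c')`; by `Restorable.qpOrbitRestorable_of_invariant` (every invariant
  polynomial at level `n` is restorable with constant `n! + 5`) the bad levels satisfy `c' < n(c')! + 5`, so each level
  carries finitely many `c'`; the family picking at each such level the bad polynomial of the LARGEST `c'` (and `1`
  elsewhere) is matrix-symmetric and lies in `PDClass 1 · (max c 8)`, so A_∞ restores it with some `c₀` — contradiction
  at the level `n(c₀)`.)
* `uniform_finset_sum` — in uniform form the class of restorable level-`n` polynomials is closed under finite sums of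
  matrix-symmetric `PDClass`-members at no cost in the exponent bookkeeping (with `ValueOrbit.qpOrbitRestorable_finset_sum`),
  which is how levelwise decompositions (homogeneous components `ValueOrbitDivision.qpOrbitRestorable_homogeneousComponent`,
  graded pieces, orbit sums) are meant to be used toward A_∞.

Honest label: a reformulation (no loss, no gain in strength) that removes the family bookkeeping from every future
reduction; no stub is closed; VP ≠ VNP is not touched. [folklore]
-/

noncomputable section

open scoped Classical

-- `Summit.ValiantsHypothesis.ValiantsHypothesis.…` is the tree's single-conjunct layout (Sub = Summit).
set_option linter.dupNamespace false

namespace Summit.ValiantsHypothesis.ValiantsHypothesis.Theorems.OrbitRestorationQPDepthThreeRung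

namespace UniformForm

open Literature.Computability.AlgebraicComplexity MvPolynomial
open Summit.ValiantsHypothesis.ValiantsHypothesis.Theorems

/-- Matrix symmetry of ONE polynomial at level `n` (the levelwise content of `IsMatrixSymmetric`). [folklore] -/
theorem isMatrixSymmetric_iff_levelwise (f : (n : ℕ) → MvPolynomial (Fin n × Fin n) ℂ) :
    IsMatrixSymmetric f ↔ ∀ n, ∀ σ τ : Equiv.Perm (Fin n),
      MvPolynomial.rename (fun p : Fin n × Fin n => (σ p.1, τ p.2)) (f n) = f n :=
  Iff.rfl

/-- The constant polynomial `1` lies in `PDClass 1 n 8` (empty affine product). [folklore] -/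
theorem pdClass_one_of_one (n : ℕ) : PDClass (fun _ => 1) n 8 (1 : MvPolynomial (Fin n × Fin n) ℂ) := by
  have h := PiSigmaClass.pdClass_one_affineProd (n := n) (c := 0) (0 : Multiset (MvPolynomial (Fin n × Fin n) ℂ))
    (by simp) (by simp)
  simpa using h

/-- **A_∞ ⟺ ITS UNIFORM LEVELWISE FORM.**  The registered signature of `stub_sigmaPiSigmaValue` (left, verbatim) holds iff
for every exponent `c` there is ONE constant `c'` such that every polynomial at any level `n` which is matrix-symmetric and
lies in `PDClass 1 n c` is `QPOrbitRestorable c' n`. [folklore] -/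
theorem sigmaPiSigmaValue_iff_uniform :
    (∀ f : (n : ℕ) → MvPolynomial (Fin n × Fin n) ℂ, IsMatrixSymmetric f →
        (∃ c : ℕ, ∀ n : ℕ, PDClass (fun _ => 1) n c (f n)) →
        ∃ c : ℕ, ∀ n : ℕ, QPOrbitRestorable c n (f n)) ↔
    (∀ c : ℕ, ∃ c' : ℕ, ∀ (n : ℕ) (q : MvPolynomial (Fin n × Fin n) ℂ),
        (∀ σ τ : Equiv.Perm (Fin n), MvPolynomial.rename (fun p : Fin n × Fin n => (σ p.1, τ p.2)) q = q) →
        PDClass (fun _ => 1) n c q → QPOrbitRestorable c' n q) := by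
  constructor
  · intro hA c
    by_contra hU
    push Not at hU
    -- bad levels and bad polynomials, one per candidate constant `c'`
    have hBad : ∀ c' : ℕ, ∃ n : ℕ, ∃ q : MvPolynomial (Fin n × Fin n) ℂ,
        (∀ σ τ : Equiv.Perm (Fin n), MvPolynomial.rename (fun p : Fin n × Fin n => (σ p.1, τ p.2)) q = q) ∧
        PDClass (fun _ => 1) n c q ∧ ¬ QPOrbitRestorable c' n q := by
      intro c'
      obtain ⟨n, q, hs, hpd, hbad⟩ := hU c'
      exact ⟨n, q, hs, hpd, hbad⟩
    choose nf hnf using hBad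
    -- every bad level is large: `c' < (nf c')! + 5`
    have hlt : ∀ c', c' < (nf c').factorial + 5 := by
      intro c'
      by_contra hle
      push Not at hle
      obtain ⟨q, hs, -, hbad⟩ := hnf c'
      exact hbad (Restorable.qpOrbitRestorable_mono hle
        (Restorable.qpOrbitRestorable_of_invariant q fun σ => ValueOrbit.ren_eq_of_matrixSymmetric hs σ))
    -- the finite fibre of candidate constants above a level, and its top element
    let fiber : ℕ → Finset ℕ := fun m => (Finset.range (m.factorial + 5)).filter fun c' => nf c' = m
    have hmem_fiber : ∀ c', c' ∈ fiber (nf c') := fun c' =>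
      Finset.mem_filter.2 ⟨Finset.mem_range.2 (hlt c'), rfl⟩
    have hfiber_level : ∀ {m c'}, c' ∈ fiber m → nf c' = m := fun h => (Finset.mem_filter.1 h).2
    have hBadAt : ∀ (m : ℕ) (h : (fiber m).Nonempty), ∃ q : MvPolynomial (Fin m × Fin m) ℂ,
        (∀ σ τ : Equiv.Perm (Fin m), MvPolynomial.rename (fun p : Fin m × Fin m => (σ p.1, τ p.2)) q = q) ∧
        PDClass (fun _ => 1) m c q ∧ ¬ QPOrbitRestorable ((fiber m).max' h) m q := by
      intro m h
      have hlev : nf ((fiber m).max' h) = m := hfiber_level (Finset.max'_mem _ h)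
      have := hnf ((fiber m).max' h)
      rw [hlev] at this
      exact this
    -- the diagonal family
    let f : (m : ℕ) → MvPolynomial (Fin m × Fin m) ℂ := fun m =>
      if h : (fiber m).Nonempty then Classical.choose (hBadAt m h) else 1
    have hf_pos : ∀ {m} (h : (fiber m).Nonempty), f m = Classical.choose (hBadAt m h) := fun h => by
      simp only [f, dif_pos h]
    have hf_neg : ∀ {m}, ¬ (fiber m).Nonempty → f m = 1 := fun h => by simp only [f, dif_neg h]
    have hsym : IsMatrixSymmetric f := by
      intro m σ τ
      by_cases h : (fiber m).Nonempty
      · rw [hf_pos h]; exact (Classical.choose_spec (hBadAt m h)).1 σ τ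
      · rw [hf_neg h, map_one]
    have hpd : ∃ c₁ : ℕ, ∀ m : ℕ, PDClass (fun _ => 1) m c₁ (f m) := by
      refine ⟨max c 8, fun m => ?_⟩
      by_cases h : (fiber m).Nonempty
      · rw [hf_pos h]
        exact ExplicitForm.pdClass_mono_const (le_max_left _ _) (Classical.choose_spec (hBadAt m h)).2.1
      · rw [hf_neg h]
        exact ExplicitForm.pdClass_mono_const (le_max_right _ _) (pdClass_one_of_one m)
    obtain ⟨c₀, hc₀⟩ := hA f hsym hpd
    -- contradiction at the bad level of `c₀`
    set m := nf c₀ with hm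
    have hne : (fiber m).Nonempty := ⟨c₀, hmem_fiber c₀⟩
    have hle : c₀ ≤ (fiber m).max' hne := Finset.le_max' _ _ (hmem_fiber c₀)
    have hres : QPOrbitRestorable ((fiber m).max' hne) m (Classical.choose (hBadAt m hne)) := by
      rw [← hf_pos hne]
      exact Restorable.qpOrbitRestorable_mono hle (hc₀ m)
    exact (Classical.choose_spec (hBadAt m hne)).2.2 hres
  · intro hU f hsym hpd
    obtain ⟨c, hc⟩ := hpd
    obtain ⟨c', hc'⟩ := hU c
    exact ⟨c', fun n => hc' n (f n) (hsym n) (hc n)⟩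

/-- **Levelwise finite sums in uniform form.**  If the uniform form holds at exponent `c` with constant `c'`, then any
finite sum of matrix-symmetric members of `PDClass 1 n c` is `QPOrbitRestorable (c' + 3) n` — whatever the number of
summands (e.g. the homogeneous components of a polynomial, once each is known to lie in the class). [folklore] -/
theorem uniform_finset_sum {c c' n : ℕ}
    (hU : ∀ (q : MvPolynomial (Fin n × Fin n) ℂ),
        (∀ σ τ : Equiv.Perm (Fin n), MvPolynomial.rename (fun p : Fin n × Fin n => (σ p.1, τ p.2)) q = q) →
        PDClass (fun _ => 1) n c q → QPOrbitRestorable c' n q)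
    {ι : Type*} (s : Finset ι) (p : ι → MvPolynomial (Fin n × Fin n) ℂ)
    (hsym : ∀ i ∈ s, ∀ σ τ : Equiv.Perm (Fin n),
      MvPolynomial.rename (fun x : Fin n × Fin n => (σ x.1, τ x.2)) (p i) = p i)
    (hpd : ∀ i ∈ s, PDClass (fun _ => 1) n c (p i)) :
    QPOrbitRestorable (c' + 3) n (∑ i ∈ s, p i) :=
  ValueOrbit.qpOrbitRestorable_finset_sum s p fun i hi => hU (p i) (hsym i hi) (hpd i hi)

end UniformForm

end Summit.ValiantsHypothesis.ValiantsHypothesis.Theorems.OrbitRestorationQPDepthThreeRung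

end
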